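import Literature.NumberTheory.EllipticCurves.LocalTateDualityPoints
import Literature.NumberTheory.PAdicHodge.DualExpEllipticOfReciprocity
import Literature.NumberTheory.GaloisRepresentations.RestrictConjugateIso
import HarnessLib

/-!
# (S5b)/(S5b-tower) for an elliptic curve over a `p`-adic field REDUCED TO THE RECIPROCITY LAW: Tate duality with the Kummer
# image, in the exact shape the assembly consumes, at one level and along a tower

Topic `NumberTheory/EllipticCurves`; namespace `Literature.NumberTheory.EllipticCurves`. Capstone of bricks K2/K4 of the hT₂ programme
of crux K★ stmt-BirchSwinnertonDyer-22226 (memo `Summits/BirchSwinnertonDyer/BirchSwinnertonDyer/Cruxes/StarredOptimalManinUnitFiveSeven/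
Lines/kato-lever-hT2-programme.md`). Two transport definitions (`restrictedTateRepTowerIso`, `tatePairingPointTower`) and theorems; no
named fact, no instance, no `sorry`.

The assembly `PAdicHodge.range_expStarCoord_smul_iff_of_reciprocity` / `PAdicHodge.exists_smul_range_tower_of_reciprocity`
(`DualExpEllipticOfReciprocity.lean`) derives the clause(s) of the cite facts (S5b)/(S5b-tower)
(`PAdicHodge.exists_smul_range_expStarCoord(_tower)_iff_trace_log`, Kato II Thm. 1.4.1 / BK90 Prop. 3.8) for ANY `ℤ_p`-valued pairings
`B(η, P)` from the hypotheses [REC] (explicit reciprocity), [TD] (`htd`: every additive `φ : E(F) → ℤ_p` is `B(η, ·)`), [N], [ADD]. For THE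
pairing of the tree — the local Tate pairing with the Kummer image `B(η, P) := ⟨[η], P⟩ = tatePairingPoint … [η] P`
(`LocalTatePairingPoints.lean`) — [TD] is the THEOREM `exists_tatePairingPoint_eq` (`LocalTateDualityPoints.lean`). This file provides
[TD] in the exact `htd` shape, at one level and for the TOWER representation of hT₂:

* ★ `exists_contOneCocycles_tatePairingPoint_eq` — `∀ φ, ∃ η : contOneCocycles (T_pW|_{Γ_F}), ∀ P, ⟨[η], P⟩ = φ P` (one level);
* `restrictedTateRepTowerIso` — `T_pW|_{Γ_F} ≅ (T_pW|_{Γ_{F₀}})|_{Γ_F}`: hT₂ speaks of the tower representation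
  `(restrictedTateRep W F₀ p).restrict (absGaloisRestrict F₀ F)`, isomorphic — not equal — to `restrictedTateRep W F p` (the two
  restriction maps `Γ_F → Γ_{K₀}` are conjugate; `GaloisRepresentations/RestrictConjugateIso.lean`, `restrictTowerIso` for `T = T_pW`);
* `tatePairingPointTower` — the transported pairing `⟨y′, P⟩ := ⟨H¹(γ⁻¹) y′, P⟩` of the tower representation with `E(F)`;
  ★ `exists_tatePairingPointTower_eq`, ★ `exists_contOneCocycles_tatePairingPointTower_eq` — its duality theorem ([TD] for the tower);
* two `example`s recording the RECIPES: the (S5b) clause, resp. the conclusion of hT₂ VERBATIM (both clauses, one constant), follow by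
  ONE application of the assembly fed with these theorems — so what remains of hT₂ is [REC] (Kato II Thm. 1.4.1 (4) for `V_pW`, at `F₀`
  and at `F` with one constant), [N], [ADD] and the Prop-1.2.3 binders hT₂ quantifies over. BSD is not proved by any of this.

## References
* K. Kato, LNM 1553 (1993), Ch. II Thm. 1.4.1 (3)–(4), Lemma 1.4.3–1.4.5. [Kato1993LNM1553]
* S. Bloch, K. Kato (1990), Prop. 3.8, Ex. 3.10.1, Example 3.11. [BlochKato1990]
* J. Neukirch, A. Schmidt, K. Wingberg (2008), (7.2.6). [NeukirchSchmidtWingberg2008]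
* J. S. Milne, *Arithmetic Duality Theorems* (2006), I Cor. 2.3, I §3 Cor. 3.4. [MilneADT2006]
-/

noncomputable section

open scoped Classical NNReal
open CategoryTheory Field ValuativeRel
open Literature.NumberTheory.GaloisRepresentations
open Literature.NumberTheory.GaloisRepresentations.IsNonarchimedeanLocalField
open Literature.NumberTheory.PAdicHodge
open WeierstrassCurve

namespace Literature.NumberTheory.EllipticCurves

/-! ### One level -/

section OneLevel

variable {K₀ : Type} [Field K₀] [CharZero K₀] (W : WeierstrassCurve K₀) [W.IsElliptic]
  {F : Type} [Field F] [Algebra K₀ F] {p : ℕ} [Fact p.Prime]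
  -- the level-compatible Weil pairings (`exists_weilPairing_tower`)
  (e : (k : ℕ) → geomTorsion W ((p ^ k : ℕ) : ℤ) → geomTorsion W ((p ^ k : ℕ) : ℤ) → AlgebraicClosure K₀)
  (hμ : ∀ k S T, e k S T ^ (p ^ k) = 1)
  (hadd₁ : ∀ k S₁ S₂ T, e k (S₁ + S₂) T = e k S₁ T * e k S₂ T)
  (hadd₂ : ∀ k S T₁ T₂, e k S (T₁ + T₂) = e k S T₁ * e k S T₂)
  (hgal : ∀ k (σ : absoluteGaloisGroup K₀) (S T : geomTorsion W ((p ^ k : ℕ) : ℤ)),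
    σ • e k S T = e k (σ • S) (σ • T))
  (hnondeg : ∀ k (T : geomTorsion W ((p ^ k : ℕ) : ℤ)), (∀ S, e k S T = 1) → T = 0)
  (hcompat : ∀ k (S T : geomTorsion W ((p ^ (k + 1) : ℕ) : ℤ)),
    e k (torsionMulHom W (p ^ (k + 1)) (p ^ k) p (pow_succ p k).symm S)
      (torsionMulHom W (p ^ (k + 1)) (p ^ k) p (pow_succ p k).symm T) = e (k + 1) S T ^ p)

variable [ValuativeRel F] [TopologicalSpace F] [IsNonarchimedeanLocalField F] [CharZero F]

include hnondeg in
/-- ★ **Tate duality in the shape consumed by the assembly** (`htd` of `PAdicHodge.range_expStarCoord_smul_iff_of_reciprocity`):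
every additive `φ : E(F) → ℤ_p` is `P ↦ ⟨[η], P⟩` for a continuous crossed homomorphism `η` of `T_pW|_{Γ_F}` — the tree's
`exists_tatePairingPoint_eq` on cocycles (`oneCocycleClass_surjective`). [cite: MilneADT2006, I Cor. 2.3 and I §3 Cor. 3.4] [cite: BlochKato1990, Prop. 3.8 (p. 354)] -/
theorem exists_contOneCocycles_tatePairingPoint_eq (φ : (W.baseChange F).toAffine.Point →+ ℤ_[p]) :
    ∃ η : contOneCocycles (restrictedTateRep W F p).toTopRep, ∀ P : (W.baseChange F).toAffine.Point,
      tatePairingPoint W F p e hμ hadd₁ hadd₂ hgal hcompat (oneCocycleClass _ η) P = φ P := by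
  obtain ⟨y, hy⟩ := exists_tatePairingPoint_eq W F p e hμ hadd₁ hadd₂ hgal hnondeg hcompat φ
  obtain ⟨η, rfl⟩ := oneCocycleClass_surjective _ y
  exact ⟨η, hy⟩

variable [Fact (¬ IsUnit (p : integerC F))] [IsAdicComplete (Ideal.span {(p : integerC F)}) (integerC F)]
  (hp : valuation F p < 1) [Algebra ℚ_[p] F]
  (w : Valuation F ℝ≥0) [(W.baseChange F).IsIntegral w.integer]
  (d : (bdRPeriodRingData (F := F) (p := p) hp).FilZeroLine (restrictedRationalTateRep W F p))

include hnondeg in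
/-- **Recipe (one level).** The (S5b) clause `(∃ η, exp*_{c⁻¹•d}(η) = a) ↔ ∀ P, ‖Tr(a · log_ω P)‖ ≤ 1` for THE pairing follows from
[REC] + [N] + [ADD] alone: feed the assembly with `exists_contOneCocycles_tatePairingPoint_eq`. -/
example
    (c : F) (hc : c ≠ 0)
    (hrec : ∀ (η : contOneCocycles (restrictedTateRep W F p).toTopRep) (P : (W.baseChange F).toAffine.Point),
      ((tatePairingPoint W F p e hμ hadd₁ hadd₂ hgal hcompat (oneCocycleClass _ η) P : ℤ_[p]) : ℚ_[p]) =
        Algebra.trace ℚ_[p] F (c * expStarCoord W hp d η * FormalGroupChart.padicLogPointFiniteExt w (W.baseChange F) p P))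
    (hN : ∀ b : F, (∀ P : (W.baseChange F).toAffine.Point,
      Algebra.trace ℚ_[p] F (b * FormalGroupChart.padicLogPointFiniteExt w (W.baseChange F) p P) = 0) → b = 0)
    (hadd : ∀ P Q : (W.baseChange F).toAffine.Point,
      FormalGroupChart.padicLogPointFiniteExt w (W.baseChange F) p (P + Q) =
        FormalGroupChart.padicLogPointFiniteExt w (W.baseChange F) p P +
          FormalGroupChart.padicLogPointFiniteExt w (W.baseChange F) p Q)
    (a : F) :
    (∃ η : contOneCocycles (restrictedTateRep W F p).toTopRep, expStarCoord W hp (d.smul c⁻¹ (inv_ne_zero hc)) η = a) ↔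
      ∀ P : (W.baseChange F).toAffine.Point,
        ‖Algebra.trace ℚ_[p] F (a * FormalGroupChart.padicLogPointFiniteExt w (W.baseChange F) p P)‖ ≤ 1 :=
  range_expStarCoord_smul_iff_of_reciprocity W hp w d
    (fun η P => tatePairingPoint W F p e hμ hadd₁ hadd₂ hgal hcompat (oneCocycleClass _ η) P) c hc hrec
    (exists_contOneCocycles_tatePairingPoint_eq W e hμ hadd₁ hadd₂ hgal hnondeg hcompat) hN hadd a

end OneLevel

/-! ### The tower: hT₂'s two clauses from the reciprocity laws, Tate duality discharged at BOTH levels -/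

section Tower

variable {K₀ : Type} [Field K₀] [CharZero K₀] (W : WeierstrassCurve K₀) [W.IsElliptic]
  -- the lower field `F₀ ⊇ K₀`
  (F₀ : Type) [Field F₀] [Algebra K₀ F₀]
  -- the upper field `F ⊇ F₀`
  (F : Type) [Field F] [Algebra K₀ F] [Algebra F₀ F] [IsScalarTower K₀ F₀ F]
  (p : ℕ) [Fact p.Prime]

/-- **`T_pW|_{Γ_F} ≅ (T_pW|_{Γ_{F₀}})|_{Γ_F}`**: the tree's `restrictedTateRep W F p` and the TOWER representation
`(restrictedTateRep W F₀ p).restrict (absGaloisRestrict F₀ F)` of `DualExpEllipticTower` are isomorphic topological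
`Γ_F`-representations (the two restriction maps `Γ_F → Γ_{K₀}` are conjugate: `restrictTowerIso` of
`GaloisRepresentations/RestrictConjugateIso.lean` for `T = T_pW`). [cite: NeukirchSchmidtWingberg2008, (7.2.6)] -/
def restrictedTateRepTowerIso :
    (restrictedTateRep W F p).toTopRep ≅ ((restrictedTateRep W F₀ p).restrict (absGaloisRestrict F₀ F)).toTopRep :=
  restrictTowerIso (K := K₀) (E := F₀) (F := F) (W.tateGaloisRep p (W.continuous_galoisRepTate_holds p)).toIntRep

variable {F p}
variable (e : (k : ℕ) → geomTorsion W ((p ^ k : ℕ) : ℤ) → geomTorsion W ((p ^ k : ℕ) : ℤ) → AlgebraicClosure K₀)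
  (hμ : ∀ k S T, e k S T ^ (p ^ k) = 1)
  (hadd₁ : ∀ k S₁ S₂ T, e k (S₁ + S₂) T = e k S₁ T * e k S₂ T)
  (hadd₂ : ∀ k S T₁ T₂, e k S (T₁ + T₂) = e k S T₁ * e k S T₂)
  (hgal : ∀ k (σ : absoluteGaloisGroup K₀) (S T : geomTorsion W ((p ^ k : ℕ) : ℤ)),
    σ • e k S T = e k (σ • S) (σ • T))
  (hnondeg : ∀ k (T : geomTorsion W ((p ^ k : ℕ) : ℤ)), (∀ S, e k S T = 1) → T = 0)
  (hcompat : ∀ k (S T : geomTorsion W ((p ^ (k + 1) : ℕ) : ℤ)),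
    e k (torsionMulHom W (p ^ (k + 1)) (p ^ k) p (pow_succ p k).symm S)
      (torsionMulHom W (p ^ (k + 1)) (p ^ k) p (pow_succ p k).symm T) = e (k + 1) S T ^ p)

variable [ValuativeRel F] [TopologicalSpace F] [IsNonarchimedeanLocalField F] [CharZero F]

/-- **The local Tate pairing of the TOWER representation with points**: `⟨y′, P⟩ := ⟨H¹(γ⁻¹) y′, P⟩`, the tree's
`tatePairingPoint` over `F` transported along `restrictedTateRepTowerIso`. [cite: NeukirchSchmidtWingberg2008, (7.2.6)] [cite: BlochKato1990, Prop. 3.8 (p. 354)] -/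
def tatePairingPointTower :
    continuousCohomology 1 ((restrictedTateRep W F₀ p).restrict (absGaloisRestrict F₀ F)).toTopRep →+
      (W.baseChange F).toAffine.Point →+ ℤ_[p] :=
  AddMonoidHom.mk'
    (fun y => tatePairingPoint W F p e hμ hadd₁ hadd₂ hgal hcompat
      ((cohomologyMap (restrictedTateRepTowerIso W F₀ F p).inv 1).hom y))
    fun y y' => by rw [map_add, map_add]

/-- Unfolding `tatePairingPointTower`. [cite: NeukirchSchmidtWingberg2008, (7.2.6)] -/
theorem tatePairingPointTower_apply
    (y : continuousCohomology 1 ((restrictedTateRep W F₀ p).restrict (absGaloisRestrict F₀ F)).toTopRep)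
    (P : (W.baseChange F).toAffine.Point) :
    tatePairingPointTower W F₀ e hμ hadd₁ hadd₂ hgal hcompat y P =
      tatePairingPoint W F p e hμ hadd₁ hadd₂ hgal hcompat
        ((cohomologyMap (restrictedTateRepTowerIso W F₀ F p).inv 1).hom y) P := rfl

include hnondeg in
/-- ★ **Tate duality for the tower representation**: every additive `φ : E(F) → ℤ_p` is `⟨y′, ·⟩` for a class `y′` of
the tower representation (the tree's `exists_tatePairingPoint_eq` over `F`, transported: `y′ = H¹(γ) y`).
[cite: MilneADT2006, I Cor. 2.3 and I §3 Cor. 3.4] [cite: BlochKato1990, Prop. 3.8 (p. 354)] -/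
theorem exists_tatePairingPointTower_eq (φ : (W.baseChange F).toAffine.Point →+ ℤ_[p]) :
    ∃ y : continuousCohomology 1 ((restrictedTateRep W F₀ p).restrict (absGaloisRestrict F₀ F)).toTopRep,
      ∀ P : (W.baseChange F).toAffine.Point, tatePairingPointTower W F₀ e hμ hadd₁ hadd₂ hgal hcompat y P = φ P := by
  obtain ⟨y, hy⟩ := exists_tatePairingPoint_eq W F p e hμ hadd₁ hadd₂ hgal hnondeg hcompat φ
  refine ⟨(cohomologyMap (restrictedTateRepTowerIso W F₀ F p).hom 1).hom y, fun P => ?_⟩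
  rw [tatePairingPointTower_apply, cohomologyMap_inv_hom_apply]
  exact hy P

include hnondeg in
/-- ★ **Tate duality for the tower representation in the shape consumed by the assembly** (`htd` of
`PAdicHodge.exists_smul_range_tower_of_reciprocity`): every additive `φ : E(F) → ℤ_p` is `P ↦ ⟨[η], P⟩` for a continuous crossed
homomorphism `η` of `(T_pW|_{Γ_{F₀}})|_{Γ_F}`. [cite: MilneADT2006, I Cor. 2.3 and I §3 Cor. 3.4] [cite: BlochKato1990, Prop. 3.8 (p. 354)] -/
theorem exists_contOneCocycles_tatePairingPointTower_eq (φ : (W.baseChange F).toAffine.Point →+ ℤ_[p]) :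
    ∃ η : contOneCocycles ((restrictedTateRep W F₀ p).restrict (absGaloisRestrict F₀ F)).toTopRep,
      ∀ P : (W.baseChange F).toAffine.Point,
        tatePairingPointTower W F₀ e hμ hadd₁ hadd₂ hgal hcompat (oneCocycleClass _ η) P = φ P := by
  obtain ⟨y, hy⟩ := exists_tatePairingPointTower_eq W F₀ e hμ hadd₁ hadd₂ hgal hnondeg hcompat φ
  obtain ⟨η, rfl⟩ := oneCocycleClass_surjective _ y
  exact ⟨η, hy⟩

variable [ValuativeRel F₀] [TopologicalSpace F₀] [IsNonarchimedeanLocalField F₀] [CharZero F₀]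
  [Fact (¬ IsUnit (p : integerC F₀))] [IsAdicComplete (Ideal.span {(p : integerC F₀)}) (integerC F₀)]
  (hp₀ : valuation F₀ p < 1) [Algebra ℚ_[p] F₀]
  (w₀ : Valuation F₀ ℝ≥0) [(W.baseChange F₀).IsIntegral w₀.integer]
  [Fact (¬ IsUnit (p : integerC F))] [IsAdicComplete (Ideal.span {(p : integerC F)}) (integerC F)]
  (hp : valuation F p < 1) [Algebra ℚ_[p] F]
  (w : Valuation F ℝ≥0) [(W.baseChange F).IsIntegral w.integer]
  (d₀ : (bdRPeriodRingData (F := F₀) (p := p) hp₀).FilZeroLine (restrictedRationalTateRep W F₀ p))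
  (d : (bdRPeriodRingData (F := F) (p := p) hp).FilZeroLine
    ((restrictedRationalTateRep W F₀ p).restrict (absGaloisRestrict F₀ F)))
  (c : F₀) (hc : c ≠ 0)

include hnondeg in
/-- **Recipe (tower) — the conclusion of hT₂ `PAdicHodge.exists_smul_range_expStarCoord_tower_iff_trace_log` VERBATIM from the
reciprocity laws at the two levels (one constant `c`), [N] and [ADD], Tate duality discharged at BOTH levels by this file.** -/
example
    (hrec₀ : ∀ (η₀ : contOneCocycles (restrictedTateRep W F₀ p).toTopRep) (P : (W.baseChange F₀).toAffine.Point),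
      ((tatePairingPoint W F₀ p e hμ hadd₁ hadd₂ hgal hcompat (oneCocycleClass _ η₀) P : ℤ_[p]) : ℚ_[p]) =
        Algebra.trace ℚ_[p] F₀ (c * expStarCoord W hp₀ d₀ η₀ *
          FormalGroupChart.padicLogPointFiniteExt w₀ (W.baseChange F₀) p P))
    (hrec : ∀ (η : contOneCocycles ((restrictedTateRep W F₀ p).restrict (absGaloisRestrict F₀ F)).toTopRep)
        (P : (W.baseChange F).toAffine.Point),
      ((tatePairingPointTower W F₀ e hμ hadd₁ hadd₂ hgal hcompat (oneCocycleClass _ η) P : ℤ_[p]) : ℚ_[p]) =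
        Algebra.trace ℚ_[p] F (algebraMap F₀ F c * expStarCoordTower W hp d η *
          FormalGroupChart.padicLogPointFiniteExt w (W.baseChange F) p P))
    (hN₀ : ∀ b : F₀, (∀ P : (W.baseChange F₀).toAffine.Point,
      Algebra.trace ℚ_[p] F₀ (b * FormalGroupChart.padicLogPointFiniteExt w₀ (W.baseChange F₀) p P) = 0) → b = 0)
    (hN : ∀ b : F, (∀ P : (W.baseChange F).toAffine.Point,
      Algebra.trace ℚ_[p] F (b * FormalGroupChart.padicLogPointFiniteExt w (W.baseChange F) p P) = 0) → b = 0)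
    (hadd₀ : ∀ P Q : (W.baseChange F₀).toAffine.Point,
      FormalGroupChart.padicLogPointFiniteExt w₀ (W.baseChange F₀) p (P + Q) =
        FormalGroupChart.padicLogPointFiniteExt w₀ (W.baseChange F₀) p P +
          FormalGroupChart.padicLogPointFiniteExt w₀ (W.baseChange F₀) p Q)
    (hadd : ∀ P Q : (W.baseChange F).toAffine.Point,
      FormalGroupChart.padicLogPointFiniteExt w (W.baseChange F) p (P + Q) =
        FormalGroupChart.padicLogPointFiniteExt w (W.baseChange F) p P +
          FormalGroupChart.padicLogPointFiniteExt w (W.baseChange F) p Q) :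
    ∃ (e : F₀) (he : e ≠ 0),
      (∀ a₀ : F₀,
        (∃ η₀ : contOneCocycles (restrictedTateRep W F₀ p).toTopRep,
            expStarCoord W hp₀ (d₀.smul e he) η₀ = a₀) ↔
          ∀ P : (W.baseChange F₀).toAffine.Point,
            ‖Algebra.trace ℚ_[p] F₀
                (a₀ * FormalGroupChart.padicLogPointFiniteExt w₀ (W.baseChange F₀) p P)‖ ≤ 1) ∧
      (∀ a : F,
        (∃ η : contOneCocycles ((restrictedTateRep W F₀ p).restrict (absGaloisRestrict F₀ F)).toTopRep,
            expStarCoordTower W hp (d.smul (algebraMap F₀ F e) ((map_ne_zero (algebraMap F₀ F)).mpr he)) η = a) ↔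
          ∀ P : (W.baseChange F).toAffine.Point,
            ‖Algebra.trace ℚ_[p] F
                (a * FormalGroupChart.padicLogPointFiniteExt w (W.baseChange F) p P)‖ ≤ 1) :=
  exists_smul_range_tower_of_reciprocity W hp₀ w₀ hp w d₀ d
    (fun η₀ P => tatePairingPoint W F₀ p e hμ hadd₁ hadd₂ hgal hcompat (oneCocycleClass _ η₀) P)
    (fun η P => tatePairingPointTower W F₀ e hμ hadd₁ hadd₂ hgal hcompat (oneCocycleClass _ η) P)
    c hc hrec₀ hrec
    (exists_contOneCocycles_tatePairingPoint_eq W e hμ hadd₁ hadd₂ hgal hnondeg hcompat)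
    (exists_contOneCocycles_tatePairingPointTower_eq W F₀ e hμ hadd₁ hadd₂ hgal hnondeg hcompat) hN₀ hN hadd₀ hadd

end Tower

end Literature.NumberTheory.EllipticCurves

end
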